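import Summits.Ventures.PercRepro.Night2LocalDGenP
import Summits.Ventures.PercRepro.Night2ThreeCells

/-!
# PercRepro — THE `(7, 5)` CELLS `(3, 2)`, `(2, 1)`, `(2, 0)` IN THEIR PARTIAL-SPREAD REGIMES (night-2, gen 19)

With the generic target sum in closed form (`genSum_eq`: `(c′ A + T)/(ρ λ C(n, ρ))`, `A = Aρt n ρ t`, `T = Ttop n t`),
the partial-spread theorem `localShadowHall_dgenP_of_sum` closes, at `q = 5`:
* `(3, 2)` with `m₁ = 5` (`ρ = 4`, `t = 3`, `c′ = 1/8`, `λ = 31/240`): `15 A + 120 T ≥ 62 C(n, 4)` for every `n ≥ 7`;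
* `(2, 1)` with `m₁ = 7` (`ρ = 5`, `t = 4`, `c′ = 2/9`, `λ = 61/360`): `16 A + 72 T ≥ 61 C(n, 5)` for every `n ≥ 9`;
* `(2, 0)` with `m₁ = 6` (`ρ = 6`, `t = 4`, `c′ = 5/12`, `λ = 1/8`): `5 A + 12 T ≥ 9 C(n, 6)` for every `n ≥ 10`
(bounded ranges by kernel evaluation through `Σ_{i≤ρ} C(n,i) + A + T = 2^n`, large `n` from two middle binomials).
**`localShadowHall_three_two_five_of_partial`** (every thin member with `|B ∖ K| ≥ 4` misses `≥ 5` points),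
**`localShadowHall_two_one_five_of_partial`** (`|B ∖ K| ≥ 5`, `≥ 7` points), **`localShadowHall_two_zero_five_of_partial`**
(`|B| ≥ 6`, `≥ 6` points): the residues of these three cells are the flats with a fat NON-BASIS thin member.
-/

namespace PercRepro.Shadow

open Finset PerFlat ThmH

namespace DGenP

/-- **The generic target sum in closed form** (`n ≥ ρ + t`, `ρ ≥ 1`, `λ > 0`). -/
theorem genSum_eq {n ρ t : ℕ} {c' lam : ℚ} (hn : ρ + t ≤ n) (hρ : 1 ≤ ρ) (hlam : 0 < lam) :
    genSum n ρ t c' lam =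
      (c' * (DGen.Aρt n ρ t : ℚ) + (DGen.Ttop n t : ℚ)) / ((ρ : ℚ) * lam * (n.choose ρ : ℚ)) := by
  have hρ0 : (0 : ℚ) < (ρ : ℚ) := by exact_mod_cast hρ
  have hC : (0 : ℚ) < (n.choose ρ : ℚ) := by exact_mod_cast Nat.choose_pos (by omega)
  unfold genSum
  have hterm : ∀ j ∈ Finset.Icc 1 (n - ρ),
      ((n - ρ).choose j : ℚ) * (cjG n ρ t j c' / ((ρ : ℚ) * lam * ((j + ρ).choose ρ : ℚ))) =
      (1 / ((ρ : ℚ) * lam * (n.choose ρ : ℚ))) * (cjG n ρ t j c' * (n.choose (j + ρ) : ℚ)) := by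
    intro j _
    have h := DQm1.choose_div_eq_dqm1 (n := n) (ρ := ρ) (j := j) (by omega)
    have hj : (0 : ℚ) < ((j + ρ).choose ρ : ℚ) := by exact_mod_cast Nat.choose_pos (by omega)
    rw [show ((n - ρ).choose j : ℚ) * (cjG n ρ t j c' / ((ρ : ℚ) * lam * ((j + ρ).choose ρ : ℚ))) =
        (cjG n ρ t j c' / ((ρ : ℚ) * lam)) * (((n - ρ).choose j : ℚ) / ((j + ρ).choose ρ : ℚ)) by
          field_simp, h]
    field_simp
  rw [Finset.sum_congr rfl hterm, ← Finset.mul_sum]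
  have hsplit : ∑ j ∈ Finset.Icc 1 (n - ρ), cjG n ρ t j c' * (n.choose (j + ρ) : ℚ) =
      c' * (DGen.Aρt n ρ t : ℚ) + (DGen.Ttop n t : ℚ) := by
    have hIcc : Finset.Icc 1 (n - ρ) = Finset.Ico 1 (n - ρ + 1) := by
      ext j; simp only [Finset.mem_Icc, Finset.mem_Ico]; omega
    rw [hIcc, ← Finset.sum_Ico_consecutive _ (by omega : 1 ≤ n + 1 - t - ρ) (by omega : n + 1 - t - ρ ≤ n - ρ + 1)]
    have hA : ∑ j ∈ Finset.Ico 1 (n + 1 - t - ρ), cjG n ρ t j c' * (n.choose (j + ρ) : ℚ) =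
        c' * (DGen.Aρt n ρ t : ℚ) := by
      rw [DGen.cast_Aρt, Finset.mul_sum, Finset.sum_Ico_eq_sum_range, Finset.sum_Ico_eq_sum_range]
      rw [show n + 1 - t - (ρ + 1) = n + 1 - t - ρ - 1 by omega]
      apply Finset.sum_congr rfl
      intro m hm
      rw [Finset.mem_range] at hm
      unfold cjG
      rw [if_pos (by omega), show ρ + 1 + m = 1 + m + ρ by ring]
    have hB : ∑ j ∈ Finset.Ico (n + 1 - t - ρ) (n - ρ + 1), cjG n ρ t j c' * (n.choose (j + ρ) : ℚ) =
        (DGen.Ttop n t : ℚ) := by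
      rw [DGen.cast_Ttop, Finset.sum_Ico_eq_sum_range, Finset.sum_Ico_eq_sum_range]
      rw [show n - ρ + 1 - (n + 1 - t - ρ) = n + 1 - (n + 1 - t) by omega]
      apply Finset.sum_congr rfl
      intro m hm
      rw [Finset.mem_range] at hm
      unfold cjG
      rw [if_neg (by omega), show n + 1 - t - ρ + m + ρ = n + 1 - t + m by omega, one_mul]
    rw [hA, hB]
  rw [hsplit]
  field_simp



/-! ## The cell `(3, 2)` with `m₁ = 5` -/

/-- `c′ = 1/8` at `(q, d, ρ, k, m₁) = (5, 3, 4, 2, 5)`. -/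
theorem cPrimeDGP_three_two : cPrimeDGP 5 3 4 2 5 = 1 / 8 := by
  unfold cPrimeDGP capDG reqDGP phiQ; norm_num

/-- `λ = 31/240` at `(q, d, ρ, k) = (5, 3, 4, 2)`. -/
theorem lambdaDG_three_two : lambdaDG 5 3 4 2 = 31 / 240 := by
  unfold lambdaDG capDG reqDG phiQ; norm_num

/-- `15 (C(n, 5) + C(n, 6)) ≥ 62 C(n, 4)` for `n ≥ 13`. -/
theorem three_two_growth {n : ℕ} (hn : 13 ≤ n) : 62 * n.choose 4 ≤ 15 * (n.choose 5 + n.choose 6) := by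
  obtain ⟨m, rfl⟩ : ∃ m, n = m + 13 := ⟨n - 13, by omega⟩
  have h5 := Nat.choose_succ_right_eq (m + 13) 4
  have h6 := Nat.choose_succ_right_eq (m + 13) 5
  rw [show m + 13 - 4 = m + 9 by omega] at h5
  rw [show m + 13 - 5 = m + 8 by omega] at h6
  have l5 : 9 * (m + 13).choose 4 ≤ 5 * (m + 13).choose 5 := by
    nlinarith [h5, Nat.zero_le ((m + 13).choose 4 * m)]
  have l6 : 8 * (m + 13).choose 5 ≤ 6 * (m + 13).choose 6 := by
    nlinarith [h6, Nat.zero_le ((m + 13).choose 5 * m)]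
  omega

/-- The bounded range `7 ≤ n ≤ 12` of the `(3, 2)` inequality. -/
theorem three_two_ineq_small {n : ℕ} (hn : 7 ≤ n) (hn' : n ≤ 12) :
    62 * n.choose 4 ≤ 15 * DGen.Aρt n 4 3 + 120 * DGen.Ttop n 3 := by
  have hid : (∑ i ∈ Finset.range 5, n.choose i) + DGen.Aρt n 4 3 + DGen.Ttop n 3 = 2 ^ n :=
    DGen.sum_range_add_Aρt_add_Ttop (by omega)
  have key : 62 * n.choose 4 + 15 * (∑ i ∈ Finset.range 5, n.choose i) ≤ 15 * 2 ^ n + 105 * DGen.Ttop n 3 := by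
    unfold DGen.Ttop
    interval_cases n <;> decide
  omega

/-- **The `(3, 2)` inequality** `62 C(n, 4) ≤ 15 A + 120 T` for every `n ≥ 7`. -/
theorem three_two_ineq {n : ℕ} (hn : 7 ≤ n) : 62 * n.choose 4 ≤ 15 * DGen.Aρt n 4 3 + 120 * DGen.Ttop n 3 := by
  by_cases h : n ≤ 12
  · exact three_two_ineq_small hn h
  · push Not at h
    have hA : n.choose 5 + n.choose 6 ≤ DGen.Aρt n 4 3 := DGen.Aρt_ge_two (by omega)
    have h2 := three_two_growth (by omega : 13 ≤ n)
    omega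

/-- The target sum of the cell `(3, 2)` (`m₁ = 5`) is at least `1` for every `n ≥ 7`. -/
theorem one_le_genSum_three_two {n : ℕ} (hn : 7 ≤ n) : 1 ≤ genSum n 4 3 (cPrimeDGP 5 3 4 2 5) (lambdaDG 5 3 4 2) := by
  rw [cPrimeDGP_three_two, lambdaDG_three_two, genSum_eq (by omega) (by norm_num) (by norm_num)]
  have hC : (0 : ℚ) < (n.choose 4 : ℚ) := by exact_mod_cast Nat.choose_pos (by omega)
  rw [le_div_iff₀ (by positivity)]
  have key' : (62 : ℚ) * (n.choose 4 : ℚ) ≤ 15 * (DGen.Aρt n 4 3 : ℚ) + 120 * (DGen.Ttop n 3 : ℚ) := by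
    exact_mod_cast three_two_ineq hn
  norm_num
  linarith

/-! ## The cell `(2, 1)` with `m₁ = 7` -/

/-- `c′ = 2/9` at `(q, d, ρ, k, m₁) = (5, 2, 5, 1, 7)`. -/
theorem cPrimeDGP_two_one : cPrimeDGP 5 2 5 1 7 = 2 / 9 := by
  unfold cPrimeDGP capDG reqDGP phiQ; norm_num

/-- `λ = 61/360` at `(q, d, ρ, k) = (5, 2, 5, 1)`. -/
theorem lambdaDG_two_one : lambdaDG 5 2 5 1 = 61 / 360 := by
  unfold lambdaDG capDG reqDG phiQ; norm_num

/-- `16 (C(n, 6) + C(n, 7)) ≥ 61 C(n, 5)` for `n ≥ 16`. -/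
theorem two_one_growth {n : ℕ} (hn : 16 ≤ n) : 61 * n.choose 5 ≤ 16 * (n.choose 6 + n.choose 7) := by
  obtain ⟨m, rfl⟩ : ∃ m, n = m + 16 := ⟨n - 16, by omega⟩
  have h6 := Nat.choose_succ_right_eq (m + 16) 5
  have h7 := Nat.choose_succ_right_eq (m + 16) 6
  rw [show m + 16 - 5 = m + 11 by omega] at h6
  rw [show m + 16 - 6 = m + 10 by omega] at h7
  have l6 : 11 * (m + 16).choose 5 ≤ 6 * (m + 16).choose 6 := by
    nlinarith [h6, Nat.zero_le ((m + 16).choose 5 * m)]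
  have l7 : 10 * (m + 16).choose 6 ≤ 7 * (m + 16).choose 7 := by
    nlinarith [h7, Nat.zero_le ((m + 16).choose 6 * m)]
  omega

/-- The bounded range `9 ≤ n ≤ 15` of the `(2, 1)` inequality. -/
theorem two_one_ineq_small {n : ℕ} (hn : 9 ≤ n) (hn' : n ≤ 15) :
    61 * n.choose 5 ≤ 16 * DGen.Aρt n 5 4 + 72 * DGen.Ttop n 4 := by
  have hid : (∑ i ∈ Finset.range 6, n.choose i) + DGen.Aρt n 5 4 + DGen.Ttop n 4 = 2 ^ n :=
    DGen.sum_range_add_Aρt_add_Ttop (by omega)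
  have key : 61 * n.choose 5 + 16 * (∑ i ∈ Finset.range 6, n.choose i) ≤ 16 * 2 ^ n + 56 * DGen.Ttop n 4 := by
    unfold DGen.Ttop
    interval_cases n <;> decide
  omega

/-- **The `(2, 1)` inequality** `61 C(n, 5) ≤ 16 A + 72 T` for every `n ≥ 9`. -/
theorem two_one_ineq {n : ℕ} (hn : 9 ≤ n) : 61 * n.choose 5 ≤ 16 * DGen.Aρt n 5 4 + 72 * DGen.Ttop n 4 := by
  by_cases h : n ≤ 15
  · exact two_one_ineq_small hn h
  · push Not at h
    have hA : n.choose 6 + n.choose 7 ≤ DGen.Aρt n 5 4 := DGen.Aρt_ge_two (by omega)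
    have h2 := two_one_growth (by omega : 16 ≤ n)
    omega

/-- The target sum of the cell `(2, 1)` (`m₁ = 7`) is at least `1` for every `n ≥ 9`. -/
theorem one_le_genSum_two_one {n : ℕ} (hn : 9 ≤ n) : 1 ≤ genSum n 5 4 (cPrimeDGP 5 2 5 1 7) (lambdaDG 5 2 5 1) := by
  rw [cPrimeDGP_two_one, lambdaDG_two_one, genSum_eq (by omega) (by norm_num) (by norm_num)]
  have hC : (0 : ℚ) < (n.choose 5 : ℚ) := by exact_mod_cast Nat.choose_pos (by omega)
  rw [le_div_iff₀ (by positivity)]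
  have key' : (61 : ℚ) * (n.choose 5 : ℚ) ≤ 16 * (DGen.Aρt n 5 4 : ℚ) + 72 * (DGen.Ttop n 4 : ℚ) := by
    exact_mod_cast two_one_ineq hn
  norm_num
  linarith

/-! ## The cell `(2, 0)` with `m₁ = 6` -/

/-- `c′ = 5/12` at `(q, d, ρ, k, m₁) = (5, 2, 6, 0, 6)`. -/
theorem cPrimeDGP_two_zero : cPrimeDGP 5 2 6 0 6 = 5 / 12 := by
  unfold cPrimeDGP capDG reqDGP phiQ; norm_num

/-- `λ = 1/8` at `(q, d, ρ, k) = (5, 2, 6, 0)`. -/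
theorem lambdaDG_two_zero : lambdaDG 5 2 6 0 = 1 / 8 := by
  unfold lambdaDG capDG reqDG phiQ; norm_num

/-- `5 (C(n, 7) + C(n, 8)) ≥ 9 C(n, 6)` for `n ≥ 14`. -/
theorem two_zero_growth {n : ℕ} (hn : 14 ≤ n) : 9 * n.choose 6 ≤ 5 * (n.choose 7 + n.choose 8) := by
  obtain ⟨m, rfl⟩ : ∃ m, n = m + 14 := ⟨n - 14, by omega⟩
  have h7 := Nat.choose_succ_right_eq (m + 14) 6
  have h8 := Nat.choose_succ_right_eq (m + 14) 7
  rw [show m + 14 - 6 = m + 8 by omega] at h7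
  rw [show m + 14 - 7 = m + 7 by omega] at h8
  have l7 : 8 * (m + 14).choose 6 ≤ 7 * (m + 14).choose 7 := by
    nlinarith [h7, Nat.zero_le ((m + 14).choose 6 * m)]
  have l8 : 7 * (m + 14).choose 7 ≤ 8 * (m + 14).choose 8 := by
    nlinarith [h8, Nat.zero_le ((m + 14).choose 7 * m)]
  omega

/-- The bounded range `10 ≤ n ≤ 13` of the `(2, 0)` inequality. -/
theorem two_zero_ineq_small {n : ℕ} (hn : 10 ≤ n) (hn' : n ≤ 13) :
    9 * n.choose 6 ≤ 5 * DGen.Aρt n 6 4 + 12 * DGen.Ttop n 4 := by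
  have hid : (∑ i ∈ Finset.range 7, n.choose i) + DGen.Aρt n 6 4 + DGen.Ttop n 4 = 2 ^ n :=
    DGen.sum_range_add_Aρt_add_Ttop (by omega)
  have key : 9 * n.choose 6 + 5 * (∑ i ∈ Finset.range 7, n.choose i) ≤ 5 * 2 ^ n + 7 * DGen.Ttop n 4 := by
    unfold DGen.Ttop
    interval_cases n <;> decide
  omega

/-- **The `(2, 0)` inequality** `9 C(n, 6) ≤ 5 A + 12 T` for every `n ≥ 10`. -/
theorem two_zero_ineq {n : ℕ} (hn : 10 ≤ n) : 9 * n.choose 6 ≤ 5 * DGen.Aρt n 6 4 + 12 * DGen.Ttop n 4 := by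
  by_cases h : n ≤ 13
  · exact two_zero_ineq_small hn h
  · push Not at h
    have hA : n.choose 7 + n.choose 8 ≤ DGen.Aρt n 6 4 := DGen.Aρt_ge_two (by omega)
    have h2 := two_zero_growth (by omega : 14 ≤ n)
    omega

/-- The target sum of the cell `(2, 0)` (`m₁ = 6`) is at least `1` for every `n ≥ 10`. -/
theorem one_le_genSum_two_zero {n : ℕ} (hn : 10 ≤ n) : 1 ≤ genSum n 6 4 (cPrimeDGP 5 2 6 0 6) (lambdaDG 5 2 6 0) := by
  rw [cPrimeDGP_two_zero, lambdaDG_two_zero, genSum_eq (by omega) (by norm_num) (by norm_num)]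
  have hC : (0 : ℚ) < (n.choose 6 : ℚ) := by exact_mod_cast Nat.choose_pos (by omega)
  rw [le_div_iff₀ (by positivity)]
  have key' : (9 : ℚ) * (n.choose 6 : ℚ) ≤ 5 * (DGen.Aρt n 6 4 : ℚ) + 12 * (DGen.Ttop n 4 : ℚ) := by
    exact_mod_cast two_zero_ineq hn
  norm_num
  linarith

end DGenP

variable {α : Type*} [DecidableEq α] {M : Matroid α} [M.Finite]

open scoped Classical in
/-- Every thin member forces `|G ∖ K| ≥ ρ + (q − d + 1)` (`|E ∖ G| = d ≤ q`, `kColoops + ρ = q + 1`):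
`ρ(E ∖ B) = q + 2 ≤ d + |G ∖ B|` and `|G ∖ B| ≤ |G ∖ K| − (ρ − 1)`. -/
theorem thin_card_bound {q d ρ : ℕ} {G : Finset α} (hG : G ∈ flatsQ M (q + 1)) (hd : (gr M \ G).card = d)
    (hdq : d ≤ q) (hk : kColoops M G + ρ = q + 1) {B : Finset α} (hB : B ∈ thinMembers M q G) :
    ρ + (q - d + 1) ≤ G.card - kColoops M G := by
  have hd' : (gr M \ G).card ≤ q := by omega
  have hB' : B ∈ membersIn M (Uq M (q + 2) q) G := (mem_thinMembers.1 hB).1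
  have hBU : B ∈ Uq M (q + 2) q := (mem_membersIn.1 hB').1
  have hBG : B ⊆ G := (subset_clF hBU).trans (mem_membersIn.1 hB').2
  have hK := coloops_subset_of_mem_thinMembers hG hd' hB
  have hge := card_sdiff_coloops_thin_ge hG hd' hk hB
  have hGg : G ⊆ gr M := (mem_flatsQ.1 hG).1
  have hr : M.eRk ((gr M \ B : Finset α) : Set α) = ((q + 2 : ℕ) : ℕ∞) := (mem_Uq.1 hBU).2.2
  have hsplit : gr M \ B = (gr M \ G) ∪ (G \ B) := by
    ext x; simp only [Finset.mem_sdiff, Finset.mem_union]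
    constructor
    · rintro ⟨hx, hxB⟩; by_cases hxG : x ∈ G
      · exact Or.inr ⟨hxG, hxB⟩
      · exact Or.inl ⟨hx, hxG⟩
    · rintro (⟨hx, hxG⟩ | ⟨hxG, hxB⟩)
      · exact ⟨hx, fun h => hxG (hBG h)⟩
      · exact ⟨hGg hxG, hxB⟩
  have hsub : M.eRk ((gr M \ B : Finset α) : Set α) ≤
      M.eRk ((gr M \ G : Finset α) : Set α) + M.eRk ((G \ B : Finset α) : Set α) := by
    rw [hsplit, Finset.coe_union]
    exact M.eRk_union_le_eRk_add_eRk _ _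
  have h1 : M.eRk ((gr M \ G : Finset α) : Set α) ≤ ((d : ℕ) : ℕ∞) := by
    calc M.eRk ((gr M \ G : Finset α) : Set α) ≤ ((gr M \ G : Finset α) : Set α).encard := M.eRk_le_encard _
      _ = ((d : ℕ) : ℕ∞) := by rw [Set.encard_coe_eq_coe_finsetCard, hd]
  have h2' : M.eRk ((G \ B : Finset α) : Set α) ≤ ((G \ B).card : ℕ∞) := by
    calc M.eRk ((G \ B : Finset α) : Set α) ≤ ((G \ B : Finset α) : Set α).encard := M.eRk_le_encard _
      _ = ((G \ B).card : ℕ∞) := by rw [Set.encard_coe_eq_coe_finsetCard]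
  rw [hr] at hsub
  have h3 : ((q + 2 : ℕ) : ℕ∞) ≤ ((d : ℕ) : ℕ∞) + ((G \ B).card : ℕ∞) := hsub.trans (add_le_add h1 h2')
  have h4 : q + 2 ≤ d + (G \ B).card := by exact_mod_cast h3
  have hBcard : B.card = kColoops M G + (B \ coloops M G).card := by
    rw [kColoops_eq_card_coloops, ← Finset.card_union_of_disjoint Finset.disjoint_sdiff,
      Finset.union_sdiff_of_subset hK]
  have hGB : (G \ B).card = G.card - B.card := Finset.card_sdiff_of_subset hBG
  have hBG' : B.card ≤ G.card := Finset.card_le_card hBG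
  omega

open scoped Classical in
/-- **THE `(7, 5)` CELL `(3, 2)` IN THE `5`-PARTIAL-SPREAD REGIME**: every thin member with `|B ∖ K| ≥ 4` misses at
least `5` points of `G`. -/
theorem localShadowHall_three_two_five_of_partial {G : Finset α} (hG : G ∈ flatsQ M (5 + 1))
    (hd : (gr M \ G).card = 3) (hk : kColoops M G = 2)
    (hs : ∀ e ∈ gr M, ∀ f ∈ gr M, e ≠ f → rkN M {e, f} = 2) (hl : ∀ e ∈ gr M, M.Indep {e})
    (hm₁ : ∀ B ∈ thinMembers M 5 G, 4 ≤ (B \ coloops M G).card → 5 ≤ (G \ clF M B).card) :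
    LocalShadowHall M 5 G := by
  by_cases hn : 7 ≤ G.card - kColoops M G
  · exact localShadowHall_dgenP_of_sum (d := 3) (ρ := 4) (m₁ := 5) hG hd (by norm_num) (by rw [hk])
      (by norm_num) (by omega) hs hl (by rw [hk, DGenP.cPrimeDGP_three_two]; norm_num)
      (by rw [hk, DGenP.lambdaDG_three_two]; norm_num) hm₁
      (by rw [hk] at hn ⊢; exact DGenP.one_le_genSum_three_two hn)
  · -- fewer than 7 points off the coloops: there is no thin member at all
    exact localShadowHall_of_spread (ρ := 4) (m₀ := 9) hG hd (by norm_num) (by rw [hk])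
      (fun B hB => absurd (thin_card_bound (ρ := 4) hG hd (by norm_num) (by rw [hk]) hB) (by omega))
      (by rw [hk]; unfold phiQ; norm_num)

open scoped Classical in
/-- **THE `(7, 5)` CELL `(2, 1)` IN THE `7`-PARTIAL-SPREAD REGIME**: every thin member with `|B ∖ K| ≥ 5` misses at
least `7` points of `G`. -/
theorem localShadowHall_two_one_five_of_partial {G : Finset α} (hG : G ∈ flatsQ M (5 + 1))
    (hd : (gr M \ G).card = 2) (hk : kColoops M G = 1)
    (hs : ∀ e ∈ gr M, ∀ f ∈ gr M, e ≠ f → rkN M {e, f} = 2) (hl : ∀ e ∈ gr M, M.Indep {e})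
    (hm₁ : ∀ B ∈ thinMembers M 5 G, 5 ≤ (B \ coloops M G).card → 7 ≤ (G \ clF M B).card) :
    LocalShadowHall M 5 G := by
  by_cases hn : 9 ≤ G.card - kColoops M G
  · exact localShadowHall_dgenP_of_sum (d := 2) (ρ := 5) (m₁ := 7) hG hd (by norm_num) (by rw [hk])
      (by norm_num) (by omega) hs hl (by rw [hk, DGenP.cPrimeDGP_two_one]; norm_num)
      (by rw [hk, DGenP.lambdaDG_two_one]; norm_num) hm₁
      (by rw [hk] at hn ⊢; exact DGenP.one_le_genSum_two_one hn)
  · exact localShadowHall_of_spread (ρ := 5) (m₀ := 8) hG hd (by norm_num) (by rw [hk])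
      (fun B hB => absurd (thin_card_bound (ρ := 5) hG hd (by norm_num) (by rw [hk]) hB) (by omega))
      (by rw [hk]; unfold phiQ; norm_num)

open scoped Classical in
/-- **THE `(7, 5)` CELL `(2, 0)` IN THE `6`-PARTIAL-SPREAD REGIME**: every thin member with `|B| ≥ 6` misses at least
`6` points of `G`. -/
theorem localShadowHall_two_zero_five_of_partial {G : Finset α} (hG : G ∈ flatsQ M (5 + 1))
    (hd : (gr M \ G).card = 2) (hk : kColoops M G = 0)
    (hs : ∀ e ∈ gr M, ∀ f ∈ gr M, e ≠ f → rkN M {e, f} = 2) (hl : ∀ e ∈ gr M, M.Indep {e})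
    (hm₁ : ∀ B ∈ thinMembers M 5 G, 6 ≤ (B \ coloops M G).card → 6 ≤ (G \ clF M B).card) :
    LocalShadowHall M 5 G := by
  by_cases hn : 10 ≤ G.card - kColoops M G
  · exact localShadowHall_dgenP_of_sum (d := 2) (ρ := 6) (m₁ := 6) hG hd (by norm_num) (by rw [hk])
      (by norm_num) (by omega) hs hl (by rw [hk, DGenP.cPrimeDGP_two_zero]; norm_num)
      (by rw [hk, DGenP.lambdaDG_two_zero]; norm_num) hm₁
      (by rw [hk] at hn ⊢; exact DGenP.one_le_genSum_two_zero hn)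
  · exact localShadowHall_of_spread (ρ := 6) (m₀ := 5) hG hd (by norm_num) (by rw [hk])
      (fun B hB => absurd (thin_card_bound (ρ := 6) hG hd (by norm_num) (by rw [hk]) hB) (by omega))
      (by rw [hk]; unfold phiQ; norm_num)

end PercRepro.Shadow
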